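import Summits.QuantumFields.YangMills.Theorems.LuscherReductionDressedRitzPolyakovLiftPScalingAssembly
import Summits.QuantumFields.YangMills.Theorems.LuscherReductionDressedRitzPolyakovLiftTransplantFormsTwoRadii
import Summits.QuantumFields.YangMills.Theorems.LuscherReductionDressedRitzPolyakovLiftPScalingLevelsWindow
import Summits.QuantumFields.YangMills.Theorems.LuscherReductionDressedRitzPolyakovLiftTransplantSup
import Summits.QuantumFields.YangMills.Theorems.LuscherReductionDressedRitzPolyakovLiftPScalingParams
import Summits.QuantumFields.YangMills.Theorems.LuscherReductionDressedRitzPolyakovLiftClusterDeltaBound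
import Literature.Analysis.OperatorTheory.YangMillsMatrixModelGroundStateLowerBound
import HarnessLib

/-!
# Route `LuscherReduction`, item `DressedRitz` (stmt-QuantumFields-20205), line «polyakovlift» r7, stub S-PSCAL″ — THE QUASIMODE PACKAGE (Q)
# (F9 layer D5, producer of the (Q)-hypotheses of `PScal.pscaling_core`; statement and proof design by the LEAD prover ym-lead-20205-polyakovlift g2
# (`PScalingQuasimodes-DRAFT.lean`, final-cycle handoff 2026-08-27 21:39Z), re-assembled over the landed two-radii package and split into
# heartbeat-sized lemmas by seat ym-infvol-p2 g8)

For a cluster end `K ≥ k` and an AL1 family `F_0,…,F_K` with `F_0 > 0` this file PRODUCES, at every coupling `B = 2L³/Λ³` in the regime of explicit side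
conditions, the quasimode data consumed by `PScal.pscaling_core`: the explicit family `Ψ_j = (χ_{ρ_j}F_j)∘gnCoord(Λ/(2L))` (`ρ_0 = 2/Λ`, `ρ_j = radiusR Λ = Λ^{−1/4}`),
its first moments `θ_j` (F6a, tree `TransplantForms.trialStates_package` / `oneSite_package`), physicality and positivity, near-orthogonality with one `ε`
(F6c, `abs_l2_trial_trial_le_rel`), the window/gap data (`PScal.levels_window`, θ-form of (w3)), the cluster-smallness and `δ ≤ Λ²/4` (via
`ClusterInd.clusterDelta_le_geom`), `λ_1 < θ_0`, the sup bound `C_f = (C_F/c_Q)e^{4R⁴/18}` of the transplanted observables (`abs_transplantFn_le_of_quarticFloor` +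
the ground-state lower bound `YMMatrixModel.luscherGroundStateLowerBound`, `a = 1/18`), and the contamination smallness — ★★ `quasimode_package`, in the shape
«∃ constants, ∀ L Λ, explicit side conditions → ∃ Ψ θ ε s κ C_f, the eighteen (Q)-hypotheses verbatim» (the LEAD's text of record, character for character).

HONEST FRAMING: fixed-lattice one-site bookkeeping (conditional femto rung R2b1); nothing here bears on infinite volume, the continuum limit or the Clay gap.
References: Reed–Simon IV, Thm. XIII.1 [cite: ReedSimonIV1978, Thm. XIII.1]; M. Lüscher, NPB 219 (1983) 233 [cite: Luscher1983, §2–§3];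
R. Carmona, B. Simon, CMP 80 (1981) 59 [cite: CarmonaSimon1981].
-/

set_option autoImplicit false

noncomputable section

open MeasureTheory Filter Topology Real Finset
open Literature.MathematicalPhysics.QuantumFieldTheory (GaugeConfig Site gaugeTransform)
open Literature.Analysis.OperatorTheory.YMMatrixModel
open scoped BigOperators

namespace Summit.QuantumFields.YangMills.Theorems.FemtoTransferGap.PScal

open Summit.QuantumFields.YangMills.Theorems.FemtoTransferGap
open Summit.QuantumFields.YangMills.Theorems.FemtoTransferGap.PolyakovLift
open Summit.QuantumFields.YangMills.Theorems.FemtoTransferGap.TransplantForms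
open Summit.QuantumFields.YangMills.Theorems.FemtoTransferGap.ClusterInd (clusterDelta clusterDelta_le_geom)

/-! ## §1 Small tools (pure real arithmetic, kept out of the big context) -/

/-- The near-orthogonality coefficient `(u+t)/((1−u)(1−t))` is at most `2(u′+t′)` when `u ≤ u′ ≤ 1/4`, `t ≤ t′ ≤ 1/4`. [folklore] -/
theorem gram_coeff_le {u t u' t' : ℝ} (hu : 0 ≤ u) (ht : 0 ≤ t) (huu : u ≤ u') (htt : t ≤ t') (hu' : u' ≤ 1 / 4) (ht' : t' ≤ 1 / 4) :
    (u + t) / ((1 - u) * (1 - t)) ≤ 2 * (u' + t') := by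
  have hden : (9 : ℝ) / 16 ≤ (1 - u) * (1 - t) := by nlinarith
  have hden0 : 0 < (1 - u) * (1 - t) := by linarith
  rw [div_le_iff₀ hden0]
  nlinarith

/-- The vacuum budget: `λ₀ − θ₀ ≤ s₀(λ₀ − λ₁)`, `0 < λ₀ − λ₁`, `s₀ ≤ 1/2` ⇒ `λ₁ < θ₀`, `(λ₀ − λ₁)/2 ≤ θ₀ − λ₁` and
`(λ₀ − θ₀)/(θ₀ − λ₁) ≤ 2s₀`. [folklore] -/
theorem vacuum_budget {l0 l1 th s₀ : ℝ} (hgap : 0 < l0 - l1) (hs : 0 ≤ s₀) (hs2 : s₀ ≤ 1 / 2) (hvac : l0 - th ≤ s₀ * (l0 - l1)) :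
    l1 < th ∧ (l0 - l1) / 2 ≤ th - l1 ∧ (l0 - th) / (th - l1) ≤ 2 * s₀ := by
  have hp := mul_nonneg (by linarith : (0 : ℝ) ≤ 1 / 2 - s₀) hgap.le
  have hden : (l0 - l1) / 2 ≤ th - l1 := by nlinarith
  have hpos : 0 < th - l1 := by linarith
  refine ⟨by linarith, hden, ?_⟩
  rw [div_le_iff₀ hpos]
  nlinarith

/-- The contamination budget: `ratio ≤ 2s₀`, `0 < ‖Ψ₀‖² ≤ 8c`, `4c ≤ ‖Ψ_{i+1}‖²`, `Cf²s₀ ≤ Λ⁴/256` ⇒ `Cf²·(ratio·‖Ψ₀‖²) ≤ (Λ²/8)²‖Ψ_{i+1}‖²`. [folklore] -/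
theorem contamination_budget {Cf ratio s₀ c X0 Xi Λ : ℝ} (hc : 0 < c) (hs : 0 ≤ s₀) (hratio : ratio ≤ 2 * s₀)
    (hX0 : 0 < X0) (hX0hi : X0 ≤ 8 * c) (hXi : 4 * c ≤ Xi) (hSC : Cf ^ 2 * s₀ ≤ Λ ^ 4 / 256) :
    Cf ^ 2 * (ratio * X0) ≤ (Λ ^ 2 / 8) ^ 2 * Xi := by
  have hfirst : ratio * X0 ≤ 2 * s₀ * (8 * c) := by
    rcases le_or_gt 0 ratio with hr | hr
    · exact mul_le_mul hratio hX0hi hX0.le (by positivity)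
    · have h1 : ratio * X0 ≤ 0 := mul_nonpos_of_nonpos_of_nonneg hr.le hX0.le
      have h2 : 0 ≤ 2 * s₀ * (8 * c) := by positivity
      linarith
  calc Cf ^ 2 * (ratio * X0) ≤ Cf ^ 2 * (2 * s₀ * (8 * c)) := mul_le_mul_of_nonneg_left hfirst (sq_nonneg Cf)
    _ = 16 * c * (Cf ^ 2 * s₀) := by ring
    _ ≤ 16 * c * (Λ ^ 4 / 256) := mul_le_mul_of_nonneg_left hSC (by positivity)
    _ = (Λ ^ 2 / 8) ^ 2 * (4 * c) := by ring
    _ ≤ (Λ ^ 2 / 8) ^ 2 * Xi := mul_le_mul_of_nonneg_left hXi (sq_nonneg _)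

/-- `12μ²R_v² = 12/L²` for `μ = Λ/(2L)`, `R_v = 2/Λ`. [folklore] -/
theorem window_radiusV_eq {Λ : ℝ} (hΛ : 0 < Λ) {L : ℕ} (hL : 0 < L) :
    12 * (Λ / (2 * (L : ℝ))) ^ 2 * (2 / Λ) ^ 2 = 12 / (L : ℝ) ^ 2 := by
  have hLr : (0 : ℝ) < L := by exact_mod_cast hL
  field_simp

/-- `R ≤ R_v`: `Λ^{−1/4} ≤ 2/Λ` for `0 < Λ ≤ 1`. [folklore] -/
theorem radiusR_le_radiusV {Λ : ℝ} (hΛ : 0 < Λ) (hΛ1 : Λ ≤ 1) : radiusR Λ ≤ 2 / Λ := by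
  have h := sqrt_two_mul_radiusR_le hΛ hΛ1
  have h1 : 1 ≤ Real.sqrt 2 := by
    rw [show (1 : ℝ) = Real.sqrt 1 by simp]
    exact Real.sqrt_le_sqrt (by norm_num)
  have hR0 := radiusR_nonneg Λ
  nlinarith

/-! ## §2 ★★ The quasimode package -/

variable {K k : ℕ}

/-- ★★ **The quasimode package (Q)** for `PScal.pscaling_core`, in the shape «∃ constants, ∀ L Λ, explicit side conditions → the eighteen (Q)-hypotheses».
Constants: `A, Kc` (F6 at two radii), `CfF` (uniform decay), `cQ` (ground-state floor at rate `1/18`), `C₁, cgap, Ctop, B₁` (levels), `I₉ = ∫e^{−‖y‖}`.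
Side conditions at `(L, Λ)`, with `R = radiusR Λ`, `ε♭ = 24/L² + 4CfF²I₉e^{−R}`, `s♭ = ((C₁ + (E_{K+1}+C₁)² + Kc/4)(Λ/L) + Ae^{−R})/cgap`,
`s₀ = (same)(Λ/L) + Ae^{−2/Λ})/cgap`, `A′ = 2(K+1)(1+Ctop/cgap)+1`: `B₁ ≤ B`, `π ≤ B`, `Ae^{−R} ≤ 1/4`, `CfF²I₉e^{−R} ≤ 1/16`,
`(K+1)(ε♭ + (2A′+1)^{K+2}(s♭ + 2A′ε♭²)) ≤ 1/2`, `(2A′+1)^{K+2}(s♭ + 2A′ε♭²) ≤ Λ²/4`, `s₀ ≤ 1/2`, `(CfF/cQ)²e^{8R⁴/18}·s₀ ≤ Λ⁴/256`.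
[cite: ReedSimonIV1978, Thm. XIII.1] [cite: Luscher1983, §2–§3] [cite: CarmonaSimon1981] -/
theorem quasimode_package (hkK : k ≤ K) (hK : idxLevel K < idxLevel (K + 1)) {F : Fin (K + 1) → ZM → ℝ} (hF : IsEigenFamily K F)
    (hFpos : ∀ x, 0 < F 0 x) :
    ∃ A Kc CfF cQ C₁ cgap Ctop B₁ I₉ : ℝ, 0 ≤ A ∧ 0 ≤ Kc ∧ 0 ≤ CfF ∧ 0 < cQ ∧ 0 ≤ C₁ ∧ 0 < cgap ∧ 0 ≤ Ctop ∧ 0 < B₁ ∧ 0 ≤ I₉ ∧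
      ∀ (L : ℕ) (Λ : ℝ), 0 < Λ → Λ ≤ 1 / 8 → 8 ≤ L →
        B₁ ≤ 2 * (L : ℝ) ^ 3 / Λ ^ 3 → π ≤ 2 * (L : ℝ) ^ 3 / Λ ^ 3 →
        A * Real.exp (-radiusR Λ) ≤ 1 / 4 → CfF ^ 2 * I₉ * Real.exp (-radiusR Λ) ≤ 1 / 16 →
        ((K + 1 : ℕ) : ℝ) * ((24 / (L : ℝ) ^ 2 + 4 * (CfF ^ 2 * I₉) * Real.exp (-radiusR Λ)) +
            (2 * (2 * ((K + 1 : ℕ) : ℝ) * (1 + Ctop / cgap) + 1) + 1) ^ (K + 1 + 1) *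
              (((C₁ + (idxLevel (K + 1) + C₁) ^ 2 + Kc / 4) * (Λ / L) + A * Real.exp (-radiusR Λ)) / cgap +
                2 * (2 * ((K + 1 : ℕ) : ℝ) * (1 + Ctop / cgap) + 1) * (24 / (L : ℝ) ^ 2 + 4 * (CfF ^ 2 * I₉) * Real.exp (-radiusR Λ)) ^ 2)) ≤ 1 / 2 →
        (2 * (2 * ((K + 1 : ℕ) : ℝ) * (1 + Ctop / cgap) + 1) + 1) ^ (K + 1 + 1) *
            (((C₁ + (idxLevel (K + 1) + C₁) ^ 2 + Kc / 4) * (Λ / L) + A * Real.exp (-radiusR Λ)) / cgap +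
              2 * (2 * ((K + 1 : ℕ) : ℝ) * (1 + Ctop / cgap) + 1) * (24 / (L : ℝ) ^ 2 + 4 * (CfF ^ 2 * I₉) * Real.exp (-radiusR Λ)) ^ 2) ≤ Λ ^ 2 / 4 →
        ((C₁ + (idxLevel (K + 1) + C₁) ^ 2 + Kc / 4) * (Λ / L) + A * Real.exp (-(2 / Λ))) / cgap ≤ 1 / 2 →
        (CfF / cQ) ^ 2 * Real.exp (2 * (4 * (1 / 18) * radiusR Λ ^ 4)) *
            (((C₁ + (idxLevel (K + 1) + C₁) ^ 2 + Kc / 4) * (Λ / L) + A * Real.exp (-(2 / Λ))) / cgap) ≤ Λ ^ 4 / 256 →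
        ∃ (Ψ : Fin (K + 1) → Cfg → ℝ) (θ : Fin (K + 1) → ℝ) (ε s κ Cf : ℝ),
          (Ψ 0 = fun U => radialCutoff (2 / Λ) (gnCoord (Λ / (2 * L)) U) * F 0 (gnCoord (Λ / (2 * L)) U)) ∧
          (∀ j : Fin (K + 1), 1 ≤ (j : ℕ) → Ψ j = fun U => radialCutoff (radiusR Λ) (gnCoord (Λ / (2 * L)) U) * F j (gnCoord (Λ / (2 * L)) U)) ∧
          (∀ j, IsPhys (Ψ j)) ∧ (∀ j, 0 < l2 (Ψ j) (Ψ j)) ∧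
          (∀ j, θ j * l2 (Ψ j) (Ψ j) ≤ qform su2Rep (2 * (L : ℝ) ^ 3 / Λ ^ 3) (Ψ j) (Ψ j)) ∧
          0 ≤ ε ∧ 0 ≤ s ∧ 0 ≤ κ ∧
          (∀ j j' : Fin (K + 1), j ≠ j' → |l2 (Ψ j) (Ψ j')| ≤ ε * Real.sqrt (l2 (Ψ j) (Ψ j)) * Real.sqrt (l2 (Ψ j') (Ψ j'))) ∧
          (∀ j : Fin (K + 1), 0 < levelValue su2Rep 1 (2 * (L : ℝ) ^ 3 / Λ ^ 3) (winLo j) - levelValue su2Rep 1 (2 * (L : ℝ) ^ 3 / Λ ^ 3) (winHi j)) ∧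
          (∀ j : Fin (K + 1), levelValue su2Rep 1 (2 * (L : ℝ) ^ 3 / Λ ^ 3) (winLo j) - θ j ≤
            s * (levelValue su2Rep 1 (2 * (L : ℝ) ^ 3 / Λ ^ 3) (winLo j) - levelValue su2Rep 1 (2 * (L : ℝ) ^ 3 / Λ ^ 3) (winHi j))) ∧
          (∀ j : Fin (K + 1), levelValue su2Rep 1 (2 * (L : ℝ) ^ 3 / Λ ^ 3) 0 - levelValue su2Rep 1 (2 * (L : ℝ) ^ 3 / Λ ^ 3) (winLo j) ≤
            κ * (levelValue su2Rep 1 (2 * (L : ℝ) ^ 3 / Λ ^ 3) (winLo j) - levelValue su2Rep 1 (2 * (L : ℝ) ^ 3 / Λ ^ 3) (winHi j))) ∧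
          ((K + 1 : ℕ) : ℝ) * (ε + clusterDelta (K + 1) κ ε s (K + 1)) ≤ 1 / 2 ∧
          levelValue su2Rep 1 (2 * (L : ℝ) ^ 3 / Λ ^ 3) 1 < θ 0 ∧
          0 ≤ Cf ∧ (∀ (i : Fin k) (y : ZM), |transplantFn (radiusR Λ) (fun j => F (Fin.castLE (Nat.succ_le_succ hkK) j)) i y| ≤ Cf) ∧
          clusterDelta (K + 1) κ ε s (K + 1) ≤ Λ ^ 2 / 4 ∧
          (∀ i : Fin k, Cf ^ 2 * ((levelValue su2Rep 1 (2 * (L : ℝ) ^ 3 / Λ ^ 3) 0 - θ 0) /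
              (θ 0 - levelValue su2Rep 1 (2 * (L : ℝ) ^ 3 / Λ ^ 3) 1) * l2 (Ψ 0) (Ψ 0)) ≤
            (Λ ^ 2 / 8) ^ 2 * l2 (Ψ ⟨(i : ℕ) + 1, by omega⟩) (Ψ ⟨(i : ℕ) + 1, by omega⟩)) := by
  -- constants
  obtain ⟨A, Kc, hA0, hKc0, hTS⟩ := trialStates_package hF
  obtain ⟨C₁, cgap, Ctop, x₀, B₁, hC₁, hcgap, hCtop, hx₀, hB₁, hlev⟩ := levels_window K hK
  have h1 := hF.1
  have h3 := hF.2.2.1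
  obtain ⟨CfF, hCfF0, hdecay⟩ := exists_uniform_decay hF.2.2.2.2
  have heq0 : ∀ x, hApply (F 0) x = physLevel 1 * F 0 x := fun x => by simpa using hF.2.2.2.1 0 x
  obtain ⟨cQ, hcQ, hfloor⟩ := luscherGroundStateLowerBound (F 0) (physLevel 1) (h1 0 2) hFpos heq0 (1 / 18) (by norm_num)
  obtain ⟨I₉, hI₉⟩ : ∃ I₉ : ℝ, I₉ = ∫ y : ZM, Real.exp (-‖y‖) := ⟨_, rfl⟩
  have hI₉0 : 0 ≤ I₉ := by rw [hI₉]; exact integral_nonneg fun y => (Real.exp_pos _).le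
  refine ⟨A, Kc, CfF, cQ, C₁, cgap, Ctop, B₁, I₉, hA0, hKc0, hCfF0, hcQ, hC₁, hcgap, hCtop, hB₁, hI₉0, ?_⟩
  intro L Λ hΛ hΛ8 hL8 hBB₁ hπB hAR hTR hSC5 hSC6 hs₀ hSC8
  -- fold the side conditions into small types (opaque scalars with defining equations)
  obtain ⟨C', hC'def⟩ : ∃ C' : ℝ, C' = C₁ + (idxLevel (K + 1) + C₁) ^ 2 + Kc / 4 := ⟨_, rfl⟩
  obtain ⟨ε, hεdef⟩ : ∃ ε : ℝ, ε = 24 / (L : ℝ) ^ 2 + 4 * (CfF ^ 2 * I₉) * Real.exp (-radiusR Λ) := ⟨_, rfl⟩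
  obtain ⟨s, hsdef⟩ : ∃ s : ℝ, s = (C' * (Λ / L) + A * Real.exp (-radiusR Λ)) / cgap := ⟨_, rfl⟩
  obtain ⟨s₀, hs₀def⟩ : ∃ s₀ : ℝ, s₀ = (C' * (Λ / L) + A * Real.exp (-(2 / Λ))) / cgap := ⟨_, rfl⟩
  obtain ⟨κ, hκdef⟩ : ∃ κ : ℝ, κ = Ctop / cgap := ⟨_, rfl⟩
  obtain ⟨Cf, hCfdef⟩ : ∃ Cf : ℝ, Cf = CfF / cQ * Real.exp (4 * (1 / 18) * radiusR Λ ^ 4) := ⟨_, rfl⟩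
  rw [← hC'def] at hSC5 hSC6 hs₀ hSC8
  rw [← hεdef, ← hsdef, ← hκdef] at hSC5 hSC6
  rw [← hs₀def] at hs₀ hSC8
  have hCf2 : (CfF / cQ) ^ 2 * Real.exp (2 * (4 * (1 / 18) * radiusR Λ ^ 4)) = Cf ^ 2 := by
    rw [hCfdef, mul_pow, sq (Real.exp _), ← Real.exp_add]; ring_nf
  rw [hCf2] at hSC8
  -- parameters
  have hΛ1 : Λ ≤ 1 := by linarith only [hΛ8]
  have hL0 : 0 < L := by omega
  have hL1 : 1 ≤ L := by omega
  have hLr : (0 : ℝ) < L := Nat.cast_pos.mpr hL0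
  have hL8r : (8 : ℝ) ≤ L := by exact_mod_cast hL8
  obtain ⟨B, hBdef⟩ : ∃ B : ℝ, B = 2 * (L : ℝ) ^ 3 / Λ ^ 3 := ⟨_, rfl⟩
  obtain ⟨μ, hμdef⟩ : ∃ μ : ℝ, μ = Λ / (2 * L) := ⟨_, rfl⟩
  obtain ⟨R, hRdef⟩ : ∃ R : ℝ, R = radiusR Λ := ⟨_, rfl⟩
  obtain ⟨Rv, hRvdef⟩ : ∃ Rv : ℝ, Rv = 2 / Λ := ⟨_, rfl⟩
  rw [← hBdef] at hBB₁ hπB ⊢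
  rw [← hRdef] at hAR hTR hεdef hsdef hCfdef ⊢
  rw [← hμdef, ← hRvdef]
  have hB : 0 < B := by rw [hBdef]; exact coupling_pos hΛ hL0
  have hμ : 0 < μ := by rw [hμdef]; positivity
  have hBμ : B * μ ^ 3 = 1 / 4 := by rw [hBdef, hμdef]; exact coupling_mul_cube hΛ hL0
  have hμ8 : μ ≤ 1 / 8 := by rw [hμdef]; exact scale_le_eighth hΛ1 (by omega)
  have hR1 : 1 ≤ R := by rw [hRdef]; exact one_le_radiusR hΛ hΛ1
  have hR0 : 0 < R := lt_of_lt_of_le one_pos hR1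
  have hRRv : R ≤ Rv := by rw [hRdef, hRvdef]; exact radiusR_le_radiusV hΛ hΛ1
  have hRvwin : Rv ≤ 1 / (8 * μ) := by rw [hRvdef, hμdef]; exact radiusV_le_window hΛ hL8
  have hwin : 12 * μ ^ 2 * Rv ^ 2 = 12 / (L : ℝ) ^ 2 := by rw [hμdef, hRvdef]; exact window_radiusV_eq hΛ hL0
  have hL2 : 12 / (L : ℝ) ^ 2 ≤ 3 / 16 := by
    rw [div_le_div_iff₀ (by positivity) (by norm_num)]; nlinarith only [hL8r]
  have hwin2 : 12 * μ ^ 2 * Rv ^ 2 ≤ 1 / 2 := by rw [hwin]; linarith only [hL2]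
  have hAR2 : A * Real.exp (-R) ≤ 1 / 2 := hAR.trans (by norm_num)
  have heRv : Real.exp (-Rv) ≤ Real.exp (-R) := Real.exp_le_exp.2 (neg_le_neg hRRv)
  have hx : bareLambda B = Λ / L := by
    have hq : 2 / B = (Λ / L) ^ 3 := by rw [hBdef]; field_simp
    unfold bareLambda
    rw [hq, show ((1 : ℝ) / 3) = ((3 : ℕ) : ℝ)⁻¹ by norm_num, Real.pow_rpow_inv_natCast (by positivity) (by norm_num)]
  have h2μ : Λ / L = 2 * μ := by rw [hμdef]; field_simp
  -- the radius assignment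
  obtain ⟨ρ, hρdef⟩ : ∃ ρ : Fin (K + 1) → ℝ, ρ = fun j : Fin (K + 1) => if (j : ℕ) = 0 then Rv else R := ⟨_, rfl⟩
  have hρj : ∀ j : Fin (K + 1), ρ j = if (j : ℕ) = 0 then Rv else R := fun j => by rw [hρdef]
  have hρ : ∀ j, R ≤ ρ j ∧ ρ j ≤ Rv := fun j => by rw [hρj]; split_ifs; exacts [⟨hRRv, le_rfl⟩, ⟨le_rfl, hRRv⟩]
  have hρ1 : ∀ j, 1 ≤ ρ j := fun j => hR1.trans (hρ j).1
  have heρ : ∀ j, Real.exp (-ρ j) ≤ Real.exp (-R) := fun j => Real.exp_le_exp.2 (neg_le_neg (hρ j).1)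
  -- F6 at the two radii (ONE call) and ONE at coupling `B`
  obtain ⟨hphys, hnorm, hθF6, -⟩ := hTS B μ hB hμ hBμ hμ8 hπB R Rv hR1 hRRv hRvwin hAR2 hwin2 ρ hρ
  obtain ⟨-, -, hν0, -, -, hwinj⟩ := hlev B hBB₁
  clear hTS hlev
  have hjK : ∀ j : Fin (K + 1), (j : ℕ) ≤ K := fun j => Nat.le_of_lt_succ j.is_lt
  have hW := fun j : Fin (K + 1) => hwinj j (hjK j)
  clear hwinj
  -- the family and its first moments as opaque functions with defining equations
  obtain ⟨Ψ, hΨdef⟩ : ∃ Ψ : Fin (K + 1) → Cfg → ℝ, Ψ = fun (j : Fin (K + 1)) (U : Cfg) => radialCutoff (ρ j) (gnCoord μ U) * F j (gnCoord μ U) := ⟨_, rfl⟩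
  obtain ⟨θ, hθdef⟩ : ∃ θ : Fin (K + 1) → ℝ,
      θ = fun j : Fin (K + 1) => linkC B ^ 3 * (1 - 2 * μ * (physLevel ((j : ℕ) + 1) + A * Real.exp (-ρ j)) - μ ^ 2 * Kc) := ⟨_, rfl⟩
  have hΨj : ∀ j, Ψ j = fun U => radialCutoff (ρ j) (gnCoord μ U) * F j (gnCoord μ U) := fun j => by rw [hΨdef]
  have hθj : ∀ j, θ j = linkC B ^ 3 * (1 - 2 * μ * (physLevel ((j : ℕ) + 1) + A * Real.exp (-ρ j)) - μ ^ 2 * Kc) := fun j => by rw [hθdef]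
  -- signs of the scalars
  have hκ0 : 0 ≤ κ := by rw [hκdef]; exact div_nonneg hCtop hcgap.le
  have hC'0 : 0 ≤ C' := by rw [hC'def]; positivity
  have hs0 : 0 ≤ s := by rw [hsdef]; positivity
  have hs₀0 : 0 ≤ s₀ := by rw [hs₀def]; positivity
  have hε0 : 0 ≤ ε := by rw [hεdef]; positivity
  have hCf0 : 0 ≤ Cf := by rw [hCfdef]; positivity
  -- physicality, first moments, norm bounds
  have HΨphys : ∀ j, IsPhys (Ψ j) := fun j => by rw [hΨj]; exact hphys j
  have Hθ : ∀ j, θ j * l2 (Ψ j) (Ψ j) ≤ qform su2Rep B (Ψ j) (Ψ j) := fun j => by rw [hΨj, hθj]; exact hθF6 j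
  have hc0 : 0 < μ ^ 9 * ((2 * π ^ 2)⁻¹) ^ 3 := by positivity
  have hD : 1 / 2 ≤ (1 - 12 * μ ^ 2 * Rv ^ 2) * (1 - A * Real.exp (-R)) := by
    rw [hwin]
    have hp := mul_nonneg (by linarith only [hL2] : (0 : ℝ) ≤ 13 / 16 - 12 / (L : ℝ) ^ 2) (by linarith only [hAR] : (0 : ℝ) ≤ 1 / 4 - A * Real.exp (-R))
    nlinarith only [hp, hL2, hAR]
  have hΨlo : ∀ j, 4 * (μ ^ 9 * ((2 * π ^ 2)⁻¹) ^ 3) ≤ l2 (Ψ j) (Ψ j) := fun j => by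
    rw [hΨj]
    refine le_trans ?_ (hnorm j).1
    have := mul_le_mul_of_nonneg_left hD (by positivity : (0 : ℝ) ≤ 8 * (μ ^ 9 * ((2 * π ^ 2)⁻¹) ^ 3))
    linarith only [this]
  have hΨhi : ∀ j, l2 (Ψ j) (Ψ j) ≤ 8 * (μ ^ 9 * ((2 * π ^ 2)⁻¹) ^ 3) := fun j => by rw [hΨj]; exact (hnorm j).2.1
  have hΨpos : ∀ j, 0 < l2 (Ψ j) (Ψ j) := fun j => lt_of_lt_of_le (by positivity) (hΨlo j)
  -- hΨ0 / hΨsucc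
  have HΨ0 : Ψ 0 = fun U => radialCutoff Rv (gnCoord μ U) * F 0 (gnCoord μ U) := by
    rw [hΨj]; funext U; rw [hρj]; simp only [Fin.val_zero, if_true]
  have HΨsucc : ∀ j : Fin (K + 1), 1 ≤ (j : ℕ) → Ψ j = fun U => radialCutoff R (gnCoord μ U) * F j (gnCoord μ U) := by
    intro j hj; rw [hΨj]; funext U
    have : (j : ℕ) ≠ 0 := by omega
    rw [hρj]; simp only [this, if_false]
  -- hgram with the uniform `ε`
  have hμRv : μ * Rv = 1 / L := by rw [hμdef, hRvdef]; field_simp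
  have hμρ : ∀ j, 12 * μ ^ 2 * ρ j ^ 2 ≤ 12 / (L : ℝ) ^ 2 := fun j => by
    rw [← hwin]
    exact mul_le_mul_of_nonneg_left (pow_le_pow_left₀ (by linarith [hρ1 j]) (hρ j).2 2) (by positivity)
  have Hgram : ∀ j j' : Fin (K + 1), j ≠ j' → |l2 (Ψ j) (Ψ j')| ≤ ε * Real.sqrt (l2 (Ψ j) (Ψ j)) * Real.sqrt (l2 (Ψ j') (Ψ j')) := by
    intro j j' hjj
    have hmax : 12 * μ ^ 2 * max (ρ j) (ρ j') ^ 2 ≤ 12 / (L : ℝ) ^ 2 := by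
      rcases le_total (ρ j) (ρ j') with h | h
      · rw [max_eq_right h]; exact hμρ j'
      · rw [max_eq_left h]; exact hμρ j
    have hCI : 0 ≤ CfF ^ 2 * I₉ := by positivity
    have htails : (CfF ^ 2 * I₉) * (Real.exp (-ρ j) + Real.exp (-ρ j')) ≤ 2 * (CfF ^ 2 * I₉) * Real.exp (-R) := by
      have h1 := mul_le_mul_of_nonneg_left (add_le_add (heρ j) (heρ j')) hCI
      linarith only [h1]
    have hT8 : 2 * (CfF ^ 2 * I₉) * Real.exp (-R) ≤ 1 / 8 := by linarith only [hTR]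
    have hwin' : 12 * μ ^ 2 * max (ρ j) (ρ j') ^ 2 < 1 := by linarith only [hmax, hL2]
    have htail' : (CfF ^ 2 * ∫ y : ZM, Real.exp (-‖y‖)) * (Real.exp (-ρ j) + Real.exp (-ρ j')) < 1 := by
      rw [← hI₉]; linarith only [htails, hT8]
    have h := abs_l2_trial_trial_le_rel hμ (hρ1 j) (hρ1 j') h1 h3 hdecay hjj hwin' htail'
    rw [← hI₉] at h
    have hcoef := gram_coeff_le (by positivity) (by positivity) hmax htails (hL2.trans (by norm_num)) (hT8.trans (by norm_num))
    rw [hΨj j, hΨj j']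
    refine h.trans ?_
    rw [mul_assoc ε]
    refine mul_le_mul_of_nonneg_right (hcoef.trans (le_of_eq (by rw [hεdef]; ring))) (by positivity)
  -- hsj
  have Hsj : ∀ j : Fin (K + 1), levelValue su2Rep 1 B (winLo j) - θ j ≤
      s * (levelValue su2Rep 1 B (winLo j) - levelValue su2Rep 1 B (winHi j)) := by
    intro j
    have h := (hW j).2.2.2.2.2.2.2 (A * Real.exp (-ρ j)) Kc (by positivity) hKc0
    have hgap := (hW j).2.2.2.2.1
    have e1 : linkC B ^ 3 * (1 - bareLambda B * (idxLevel j + A * Real.exp (-ρ j)) - bareLambda B ^ 2 * Kc / 4) = θ j := by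
      rw [hθj, hx, h2μ]; simp only [idxLevel]; ring
    rw [e1, hx] at h
    refine h.trans (mul_le_mul_of_nonneg_right ?_ hgap.le)
    rw [hsdef]
    refine div_le_div_of_nonneg_right ?_ hcgap.le
    rw [← hC'def]
    have := mul_le_mul_of_nonneg_left (heρ j) hA0
    linarith only [this]
  -- the vacuum budget `λ0 − θ0 ≤ s₀ (λ0 − λ1)`
  have hw0 : winLo ((0 : Fin (K + 1)) : ℕ) = 0 := Nat.le_zero.1 (winLo_le 0)
  have hw1 : winHi ((0 : Fin (K + 1)) : ℕ) = 1 := by simp [winHi_zero]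
  have hgap0 : 0 < levelValue su2Rep 1 B 0 - levelValue su2Rep 1 B 1 := by
    have h := (hW 0).2.2.2.2.1
    rwa [hw0, hw1] at h
  have hvac : levelValue su2Rep 1 B 0 - θ 0 ≤ s₀ * (levelValue su2Rep 1 B 0 - levelValue su2Rep 1 B 1) := by
    have h := (hW 0).2.2.2.2.2.2.2 (A * Real.exp (-Rv)) Kc (by positivity) hKc0
    rw [hw0, hw1] at h
    have e1 : linkC B ^ 3 * (1 - bareLambda B * (idxLevel ((0 : Fin (K + 1)) : ℕ) + A * Real.exp (-Rv)) - bareLambda B ^ 2 * Kc / 4) = θ 0 := by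
      rw [hθj, hx, h2μ, hρj]; simp only [idxLevel, Fin.val_zero, if_true]; ring
    rw [e1, hx] at h
    have hle : ((C₁ + (idxLevel (K + 1) + C₁) ^ 2 + Kc / 4) * (Λ / L) + A * Real.exp (-Rv)) / cgap ≤ s₀ := by
      rw [hs₀def, ← hC'def, hRvdef]
    exact h.trans (mul_le_mul_of_nonneg_right hle hgap0.le)
  have hs₀' : s₀ ≤ 1 / 2 := hs₀
  obtain ⟨Hθ0, hden, hratio⟩ := vacuum_budget hgap0 hs₀0 hs₀' hvac
  have Hκj : ∀ j : Fin (K + 1), levelValue su2Rep 1 B 0 - levelValue su2Rep 1 B (winLo j) ≤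
      κ * (levelValue su2Rep 1 B (winLo j) - levelValue su2Rep 1 B (winHi j)) := fun j => by
    rw [hκdef]; exact (hW j).2.2.2.2.2.2.1
  -- hsmall and hδ via the geometric majorant
  have hgeom := clusterDelta_le_geom (M := K + 1) (ε := ε) hκ0 hs0 (K + 1)
  have Hsmall : ((K + 1 : ℕ) : ℝ) * (ε + clusterDelta (K + 1) κ ε s (K + 1)) ≤ 1 / 2 := by
    have hK1 : (0 : ℝ) ≤ ((K + 1 : ℕ) : ℝ) := Nat.cast_nonneg _
    exact le_trans (mul_le_mul_of_nonneg_left (add_le_add le_rfl hgeom) hK1) hSC5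
  have Hδ : clusterDelta (K + 1) κ ε s (K + 1) ≤ Λ ^ 2 / 4 := hgeom.trans hSC6
  -- hCf
  have hcast0 : (Fin.castLE (Nat.succ_le_succ hkK) (0 : Fin (k + 1)) : Fin (K + 1)) = 0 := Fin.ext (by simp)
  have hfloor' : ∀ z : ZM, cQ * Real.exp (-(1 / 18 * ‖z‖ ^ 4)) ≤ (fun j => F (Fin.castLE (Nat.succ_le_succ hkK) j)) 0 z := by
    intro z
    show cQ * Real.exp (-(1 / 18 * ‖z‖ ^ 4)) ≤ F (Fin.castLE (Nat.succ_le_succ hkK) 0) z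
    rw [hcast0]; exact hfloor z
  have HCf : ∀ (i : Fin k) (y : ZM), |transplantFn R (fun j => F (Fin.castLE (Nat.succ_le_succ hkK) j)) i y| ≤ Cf := by
    intro i y
    have hfi : ∀ y, |(fun j => F (Fin.castLE (Nat.succ_le_succ hkK) j)) i.succ y| ≤ CfF := fun y => (hdecay _ y).trans
      (mul_le_of_le_one_right hCfF0 (Real.exp_le_one_iff.2 (neg_nonpos.2 (norm_nonneg y))))
    rw [hCfdef]
    exact abs_transplantFn_le_of_quarticFloor hR0 (fun j => F (Fin.castLE (Nat.succ_le_succ hkK) j)) i hfi hcQ (by norm_num) hfloor' y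
  -- hηsmall
  have Hη : ∀ i : Fin k, Cf ^ 2 * ((levelValue su2Rep 1 B 0 - θ 0) / (θ 0 - levelValue su2Rep 1 B 1) * l2 (Ψ 0) (Ψ 0)) ≤
      (Λ ^ 2 / 8) ^ 2 * l2 (Ψ ⟨(i : ℕ) + 1, by omega⟩) (Ψ ⟨(i : ℕ) + 1, by omega⟩) := fun i =>
    contamination_budget hc0 hs₀0 hratio (hΨpos 0) (hΨhi 0) (hΨlo ⟨(i : ℕ) + 1, by omega⟩) hSC8
  exact ⟨Ψ, θ, ε, s, κ, Cf, HΨ0, HΨsucc, HΨphys, hΨpos, Hθ, hε0, hs0, hκ0, Hgram, fun j => (hW j).2.2.2.2.1, Hsj,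
    Hκj, Hsmall, Hθ0, hCf0, HCf, Hδ, Hη⟩

end Summit.QuantumFields.YangMills.Theorems.FemtoTransferGap.PScal

end
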